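import Mathlib
import Summits.ValiantsHypothesis.ValiantsHypothesis.Theorems.LiouvilleSarnakLiouvilleCutRankOneBlockEmbedding

/-!
# Route LiouvilleSarnak — crux `LiouvilleCutRank` (stmt-ValiantsHypothesis-14775):
# the KERNEL embedding (any 2-kernel sequence of `λ`, any aligned block) and two-sided margins

`Theorems/LiouvilleSarnakLiouvilleCutRankOneBlockEmbedding.lean` froze the bits below a balanced window
of a cut `π` to `1` and the bits above it to the digits of an arbitrary `H`, embedding the `π₁`-cut
matrix of the SHIFTED sequence `x ↦ λ(x + 4^{n₁} H)`.  This file uses the bits BELOW the window as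
well: with the lowest `a` bits frozen to `1`, the next `s` bits frozen to the digits of an arbitrary
`Q < 2^s`, the window at position `a + s`, and `H` above it,
`N_π + 1 = 2^a · (2^s (N_{π₁} + 4^{n₁} H) + Q + 1)` and `λ(2^a y) = (-1)^a λ(y)`, so `M_π` contains
`±` the `π₁`-cut matrix of the 2-KERNEL SEQUENCE `b ↦ λ(2^s b + ρ)` (`ρ = Q + 1 ∈ [1, 2^s]`) on the
aligned block `H`:

* §1 `exists_window_count_btwn_margin₂`, `exists_balancedWindow_margin₂` — a balanced `2n₁`-window with
  `T₁` free positions BELOW and `T₂` free positions ABOVE exists in every balanced word of length `2n`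
  once `(n₁ + 1)(n₁ + T₁ + T₂) ≤ n`.
* §2 `rank_inducedCut_kernel_le` — for the induced cut `π₁` of a balanced window `[s', s' + 2n₁)` of
  `π`, every `s ≤ s'`, `Q < 2^s` and `H < 2^{2n - s' - 2n₁}`:
  `rank (λ(2^s (N_{π₁}(r,c) + 4^{n₁} H) + Q + 1))_{r,c} ≤ rank M_π`.

The consequence `LiouvilleCutRank ⟺` "for every `W` one scale `n₁` at which every balanced cut word
sees rank `≥ W` in SOME aligned block of SOME 2-kernel sequence of `λ`" is
`Theorems/LiouvilleSarnakLiouvilleCutRankKernelBlock.lean`.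

Honest framing: structural bookkeeping (the strongest form of the window method: `rank M_π` dominates
every kernel-dilated, shifted window minor); the crux `LiouvilleCutRank`, `DigitalBilinearLiouville` and
`AlgebraicSarnak` stay OPEN, and nothing here bears on VP versus VNP.  No definitions.
-/

-- the directory `ValiantsHypothesis/ValiantsHypothesis` repeats the summit name (tree layout)
set_option linter.dupNamespace false

namespace Summit.ValiantsHypothesis.ValiantsHypothesis.Theorems.LiouvilleSarnakLiouvilleCutRank.KernelBlock

open ArithmeticFunction

open Summit.ValiantsHypothesis.ValiantsHypothesis.Theorems.LiouvilleSarnakAligned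
  (liouville_two_pow_mul)
open Summit.ValiantsHypothesis.ValiantsHypothesis.Theorems.LiouvilleSarnakCutRankFour
  (count_add_count_not)
open Summit.ValiantsHypothesis.ValiantsHypothesis.Theorems.LiouvilleSarnakCutRankWindow
  (count_window_succ_le count_le_of_sparse_windows)
open Summit.ValiantsHypothesis.ValiantsHypothesis.Theorems.LiouvilleSarnakLiouvilleCutRank.OneScale
  (le_count_word_true le_count_word_false)

/-! ### §1 A balanced window with free margins on both sides -/

/-- **Counting lemma with two margins.**  Let `2c + 2 ≤ K`, `T₁ + K ≤ N ≤ 2n` and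
`T₁ + c ⌊(N - T₁)/K⌋ + min((N - T₁) mod K, c) + (2n - N) < n`.  If both `p` and `¬ p` hold at `≥ n`
of the positions `< 2n`, some window `s, …, s + K - 1` with `T₁ ≤ s` and `s + K ≤ N` contains strictly
more than `c` and strictly fewer than `K - c` positions `k` with `p k` (window counts move by `≤ 1`;
otherwise one letter is rare on `[T₁, N)` and the two margins hold at most `T₁ + (2n - N)` more).
[folklore] -/
theorem exists_window_count_btwn_margin₂ (p : ℕ → Prop) [DecidablePred p] (K c n T₁ N : ℕ)
    (hKc : 2 * c + 2 ≤ K) (hKN : T₁ + K ≤ N) (hNn : N ≤ 2 * n)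
    (hsmall : T₁ + c * ((N - T₁) / K) + min ((N - T₁) % K) c + (2 * n - N) < n)
    (hR : n ≤ Nat.count p (2 * n)) (hC : n ≤ Nat.count (fun k => ¬ p k) (2 * n)) :
    ∃ s, T₁ ≤ s ∧ s + K ≤ N ∧ c < Nat.count (fun k => p (s + k)) K ∧
      Nat.count (fun k => p (s + k)) K + c < K := by
  by_contra hno
  push Not at hno
  -- every window count in `[T₁, N)` is `≤ c` or `≥ K - c`
  have hdich : ∀ s, T₁ ≤ s → s + K ≤ N →
      Nat.count (fun k => p (s + k)) K ≤ c ∨ K ≤ Nat.count (fun k => p (s + k)) K + c := by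
    intro s hs1 hs2
    by_cases h : c < Nat.count (fun k => p (s + k)) K
    · exact Or.inr (hno s hs1 hs2 h)
    · exact Or.inl (not_lt.mp h)
  -- the two regimes do not mix
  have hregime : (∀ s, T₁ ≤ s → s + K ≤ N → Nat.count (fun k => p (s + k)) K ≤ c) ∨
      (∀ s, T₁ ≤ s → s + K ≤ N → K ≤ Nat.count (fun k => p (s + k)) K + c) := by
    rcases hdich T₁ le_rfl hKN with h0 | h0
    · left
      intro s hs
      induction s, hs using Nat.le_induction with
      | base => exact fun _ => h0
      | succ s hs ih =>
        intro hs2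
        have h1 := ih (by omega)
        have h2 := (count_window_succ_le p s K).1
        rcases hdich (s + 1) (by omega) hs2 with h3 | h3 <;> omega
    · right
      intro s hs
      induction s, hs using Nat.le_induction with
      | base => exact fun _ => h0
      | succ s hs ih =>
        intro hs2
        have h1 := ih (by omega)
        have h2 := (count_window_succ_le p s K).2
        rcases hdich (s + 1) (by omega) hs2 with h3 | h3 <;> omega
  -- counts: prefix `T₁`, middle `[T₁, N)`, suffix `2n - N`
  have hsplit : ∀ q : ℕ → Prop, ∀ [DecidablePred q] ,
      Nat.count q (2 * n) ≤ T₁ + Nat.count (fun k => q (T₁ + k)) (N - T₁) + (2 * n - N) := by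
    intro q _
    have h2n : 2 * n = (T₁ + (N - T₁)) + (2 * n - N) := by omega
    rw [h2n, Nat.count_add, Nat.count_add]
    have ha : Nat.count q T₁ ≤ T₁ := Nat.count_le _
    have hb : Nat.count (fun k => q (T₁ + (N - T₁) + k)) (2 * n - N) ≤ 2 * n - N := Nat.count_le _
    omega
  rcases hregime with hle | hge
  · have hwin : ∀ i, i + K ≤ N - T₁ → Nat.count (fun k => p (T₁ + (i + k))) K ≤ c := by
      intro i hi
      have h3 := hle (T₁ + i) (by omega) (by omega)
      simpa only [Nat.add_assoc] using h3
    have h1 := count_le_of_sparse_windows (fun k => p (T₁ + k)) K c (by omega) (N - T₁) (by omega)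
      hwin
    have h2 := hsplit p
    omega
  · have hwin : ∀ i, i + K ≤ N - T₁ → Nat.count (fun k => ¬ p (T₁ + (i + k))) K ≤ c := by
      intro i hi
      have h1 := hge (T₁ + i) (by omega) (by omega)
      have h2 := count_add_count_not (fun k => p (T₁ + i + k)) K
      have h3 : Nat.count (fun k => ¬ p (T₁ + i + k)) K ≤ c := by omega
      simpa only [Nat.add_assoc] using h3
    have h1 := count_le_of_sparse_windows (fun k => ¬ p (T₁ + k)) K c (by omega) (N - T₁)
      (by omega) hwin
    have h2 := hsplit (fun k => ¬ p k)
    omega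

/-- **A balanced window with free margins below and above.**  For `(n₁ + 1)(n₁ + T₁ + T₂) ≤ n`, the
row/column word `w` of every balanced cut `π` of `2n` positions has `2n₁` consecutive positions
`s, …, s + 2n₁ - 1` containing exactly `n₁` row bits, with `T₁ ≤ s` and `s + 2n₁ + T₂ ≤ 2n`.
[folklore] -/
theorem exists_balancedWindow_margin₂ (n₁ T₁ T₂ n : ℕ) (hn : (n₁ + 1) * (n₁ + T₁ + T₂) ≤ n)
    (π : Fin n ⊕ Fin n ≃ Fin (2 * n)) (w : ℕ → Bool)
    (hw : ∀ j : Fin (2 * n), w j = (π.symm j).isLeft) :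
    ∃ s : ℕ, T₁ ≤ s ∧ s + 2 * n₁ + T₂ ≤ 2 * n ∧
      Nat.count (fun k => w (s + k) = true) (2 * n₁) = n₁ := by
  have hTn : T₁ + T₂ ≤ n := by nlinarith [hn]
  rcases Nat.eq_zero_or_pos n₁ with rfl | hpos
  · exact ⟨T₁, le_rfl, by omega, by simp⟩
  have hn' : n₁ * (n₁ + T₁ + T₂) ≤ n := le_trans (Nat.mul_le_mul_right _ (Nat.le_succ n₁)) hn
  have hq : n₁ + T₁ + T₂ ≤ n / n₁ :=
    (Nat.le_div_iff_mul_le hpos).mpr (by rwa [Nat.mul_comm] at hn')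
  set q := n / n₁ with hqdef
  have hdivle : (2 * n - T₂ - T₁) / (2 * n₁) ≤ q := by
    calc (2 * n - T₂ - T₁) / (2 * n₁) ≤ 2 * n / (2 * n₁) :=
          Nat.div_le_div_right ((Nat.sub_le _ _).trans (Nat.sub_le _ _))
      _ = q := by rw [hqdef, Nat.mul_div_mul_left n n₁ Nat.two_pos]
  have hmul : (n₁ - 1) * ((2 * n - T₂ - T₁) / (2 * n₁)) ≤ (n₁ - 1) * q :=
    Nat.mul_le_mul_left _ hdivle
  have hmin : min ((2 * n - T₂ - T₁) % (2 * n₁)) (n₁ - 1) ≤ n₁ - 1 := min_le_right _ _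
  have hsum : (n₁ - 1) * q + q = n₁ * q := by
    rw [← Nat.succ_mul, Nat.succ_eq_add_one, Nat.sub_add_cancel hpos]
  have hnq : n₁ * q ≤ n := by rw [hqdef]; exact Nat.mul_div_le n n₁
  have hsmall : T₁ + (n₁ - 1) * ((2 * n - T₂ - T₁) / (2 * n₁)) +
      min ((2 * n - T₂ - T₁) % (2 * n₁)) (n₁ - 1) + (2 * n - (2 * n - T₂)) < n := by
    omega
  obtain ⟨s, hs1, hs2, hlo, hhi⟩ := exists_window_count_btwn_margin₂ (fun k => w k = true) (2 * n₁)
    (n₁ - 1) n T₁ (2 * n - T₂) (by omega) (by omega) (Nat.sub_le _ _) hsmall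
    (le_count_word_true n π w hw) (le_count_word_false n π w hw)
  exact ⟨s, hs1, by omega, by omega⟩

/-! ### §2 The kernel embedding -/

/-- **Kernel embedding for the induced cut.**  Let `s' + 2n₁ ≤ 2n`, `w` the row/column word of the
cut `π` on the window `s', …, s' + 2n₁ - 1`, `π₁` a level-`n₁` cut with
`(π₁.symm k).isLeft = w (s' + k)`, `s ≤ s'`, `Q < 2^s` and `H < 2^{2n - s' - 2n₁}`.  Then the `π₁`-cut
matrix of the 2-KERNEL sequence `b ↦ λ(2^s b + Q + 1)` on the aligned block `H`,
`(λ(2^s (N_{π₁}(r, c) + 4^{n₁} H) + Q + 1))_{r,c}`, has rank `≤ rank M_π`: freeze the lowest `s' - s`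
bits to `1`, the next `s` bits to the digits of `Q`, and the bits above the window to the digits of
`H`; then `N_π + 1 = 2^{s'-s} (2^s (N_{π₁} + 4^{n₁} H) + Q + 1)` and `λ(2^{s'-s} y) = ± λ(y)`.
(`s = 0`, `Q = 0` is `OneBlock.rank_inducedCut_shift_le`.) [folklore] -/
theorem rank_inducedCut_kernel_le (n₁ n : ℕ) (π : Fin n ⊕ Fin n ≃ Fin (2 * n)) (w : ℕ → Bool)
    (s' : ℕ) (hs' : s' + 2 * n₁ ≤ 2 * n)
    (hw : ∀ j : Fin (2 * n), s' ≤ (j : ℕ) → (j : ℕ) < s' + 2 * n₁ → w j = (π.symm j).isLeft)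
    (π₁ : Fin n₁ ⊕ Fin n₁ ≃ Fin (2 * n₁)) (hπ₁ : ∀ k : Fin (2 * n₁), (π₁.symm k).isLeft = w (s' + k))
    (s : ℕ) (hss : s ≤ s') (Q : ℕ) (hQ : Q < 2 ^ s)
    (H : ℕ) (hH : H < 2 ^ (2 * n - (s' + 2 * n₁))) :
    (Matrix.of fun r c : Fin n₁ → Bool =>
        (((liouville (2 ^ s * (Nat.ofBits (fun j : Fin (2 * n₁) => Sum.elim r c (π₁.symm j)) +
          2 ^ (2 * n₁) * H) + Q + 1) : ℤ) : ℂ))).rank ≤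
      (Matrix.of fun r c : Fin n → Bool =>
        (((liouville (Nat.ofBits (fun j : Fin (2 * n) => Sum.elim r c (π.symm j)) + 1) : ℤ) :
          ℂ))).rank := by
  classical
  set a : ℕ := s' - s with ha
  have hs'eq : s' = a + s := by omega
  set M₁ : Matrix (Fin n₁ → Bool) (Fin n₁ → Bool) ℂ := Matrix.of fun r c : Fin n₁ → Bool =>
      (((liouville (2 ^ s * (Nat.ofBits (fun j : Fin (2 * n₁) => Sum.elim r c (π₁.symm j)) +
        2 ^ (2 * n₁) * H) + Q + 1) : ℤ) : ℂ))
    with hM₁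
  set M : Matrix (Fin n → Bool) (Fin n → Bool) ℂ := Matrix.of fun r c : Fin n → Bool =>
      (((liouville (Nat.ofBits (fun j : Fin (2 * n) => Sum.elim r c (π.symm j)) + 1) : ℤ) : ℂ))
    with hM
  -- extension of a local window stream: `a` ones, then the digits of `Q`, the window, the digits of `H`
  let ext : (ℕ → Bool) → ℕ → Bool := fun z j =>
    if j < a then true else if j < s' then Q.testBit (j - a)
      else if j < s' + 2 * n₁ then z (j - s') else H.testBit (j - (s' + 2 * n₁))
  let xr : (Fin n₁ → Bool) → ℕ → Bool := fun r₁ k =>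
    if h : k < 2 * n₁ then Sum.elim r₁ (fun _ => false) (π₁.symm ⟨k, h⟩) else false
  let yc : (Fin n₁ → Bool) → ℕ → Bool := fun c₁ k =>
    if h : k < 2 * n₁ then Sum.elim (fun _ => false) c₁ (π₁.symm ⟨k, h⟩) else false
  let z : (Fin n₁ → Bool) → (Fin n₁ → Bool) → ℕ → Bool := fun r₁ c₁ k =>
    if h : k < 2 * n₁ then Sum.elim r₁ c₁ (π₁.symm ⟨k, h⟩) else false
  let ρ : (Fin n₁ → Bool) → (Fin n → Bool) := fun r₁ i => ext (xr r₁) (π (Sum.inl i))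
  let γ : (Fin n₁ → Bool) → (Fin n → Bool) := fun c₁ i => ext (yc c₁) (π (Sum.inr i))
  have hzr : ∀ r₁ c₁ (k : ℕ) (hk : k < 2 * n₁), (π₁.symm ⟨k, hk⟩).isLeft = true →
      z r₁ c₁ k = xr r₁ k := by
    intro r₁ c₁ k hk hl
    simp only [z, xr, dif_pos hk]
    rcases hq : π₁.symm ⟨k, hk⟩ with i | i
    · rfl
    · rw [hq, Sum.isLeft_inr] at hl
      exact absurd hl (by decide)
  have hzc : ∀ r₁ c₁ (k : ℕ) (hk : k < 2 * n₁), (π₁.symm ⟨k, hk⟩).isLeft = false →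
      z r₁ c₁ k = yc c₁ k := by
    intro r₁ c₁ k hk hl
    simp only [z, yc, dif_pos hk]
    rcases hq : π₁.symm ⟨k, hk⟩ with i | i
    · rw [hq, Sum.isLeft_inl] at hl
      exact absurd hl (by decide)
    · rfl
  -- (1) the global bit vector at `(ρ r₁, γ c₁)` is the extension of the merged local stream
  have hglob : ∀ r₁ c₁ (j : Fin (2 * n)), Sum.elim (ρ r₁) (γ c₁) (π.symm j) = ext (z r₁ c₁) j := by
    intro r₁ c₁ j
    rcases hj : π.symm j with i | i
    · have hji : π (Sum.inl i) = j := by rw [← hj, Equiv.apply_symm_apply]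
      rw [Sum.elim_inl]
      show ext (xr r₁) (π (Sum.inl i)) = ext (z r₁ c₁) j
      rw [hji]
      by_cases h0 : (j : ℕ) < a
      · simp [ext, h0]
      · by_cases h1 : (j : ℕ) < s'
        · simp [ext, h0, h1]
        · by_cases h2 : (j : ℕ) < s' + 2 * n₁
          · have hk : (j : ℕ) - s' < 2 * n₁ := by omega
            have hl : (π₁.symm ⟨(j : ℕ) - s', hk⟩).isLeft = true := by
              rw [hπ₁, show s' + ((j : ℕ) - s') = (j : ℕ) by omega, hw j (not_lt.mp h1) h2, hj,
                Sum.isLeft_inl]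
            simp [ext, h0, h1, h2, hzr r₁ c₁ _ hk hl]
          · simp [ext, h0, h1, h2]
    · have hji : π (Sum.inr i) = j := by rw [← hj, Equiv.apply_symm_apply]
      rw [Sum.elim_inr]
      show ext (yc c₁) (π (Sum.inr i)) = ext (z r₁ c₁) j
      rw [hji]
      by_cases h0 : (j : ℕ) < a
      · simp [ext, h0]
      · by_cases h1 : (j : ℕ) < s'
        · simp [ext, h0, h1]
        · by_cases h2 : (j : ℕ) < s' + 2 * n₁
          · have hk : (j : ℕ) - s' < 2 * n₁ := by omega
            have hl : (π₁.symm ⟨(j : ℕ) - s', hk⟩).isLeft = false := by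
              rw [hπ₁, show s' + ((j : ℕ) - s') = (j : ℕ) by omega, hw j (not_lt.mp h1) h2, hj,
                Sum.isLeft_inr]
            simp [ext, h0, h1, h2, hzc r₁ c₁ _ hk hl]
          · simp [ext, h0, h1, h2]
  -- (2) the number with extended bits: `N + 1 = 2^a (2^s (N₁ + 4^{n₁} H) + Q + 1)`
  have hHbit : ∀ i, 2 * n ≤ i → H.testBit (i - (s' + 2 * n₁)) = false := fun i hi =>
    Nat.testBit_lt_two_pow (lt_of_lt_of_le hH (Nat.pow_le_pow_right Nat.two_pos (by omega)))
  have hext : ∀ zz : ℕ → Bool,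
      Nat.ofBits (fun j : Fin (2 * n) => ext zz j) + 1 =
        2 ^ a * (2 ^ s * (Nat.ofBits (fun k : Fin (2 * n₁) => zz k) + 2 ^ (2 * n₁) * H) + Q + 1) := by
    intro zz
    have h1 : Nat.ofBits (fun j : Fin (2 * n) => ext zz j) =
        2 ^ a * (2 ^ s * (2 ^ (2 * n₁) * H + Nat.ofBits (fun k : Fin (2 * n₁) => zz k)) + Q) +
          (2 ^ a - 1) := by
      apply Nat.eq_of_testBit_eq
      intro i
      rw [Nat.testBit_ofBits,
        Nat.testBit_two_pow_mul_add _ (Nat.sub_lt (Nat.two_pow_pos a) Nat.one_pos),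
        Nat.testBit_two_pow_sub_one, Nat.testBit_two_pow_mul_add _ hQ,
        Nat.testBit_two_pow_mul_add _ (Nat.ofBits_lt_two_pow _), Nat.testBit_ofBits]
      by_cases hi : i < 2 * n
      · rw [dif_pos hi]
        by_cases hi0 : i < a
        · simp [ext, hi0]
        · by_cases hi1 : i < s'
          · have hi3 : i - a < s := by omega
            simp [ext, hi0, hi1, hi3]
          · by_cases hi2 : i < s' + 2 * n₁
            · have hi3 : ¬ i - a < s := by omega
              have hi4 : i - s' < 2 * n₁ := by omega
              have hi5 : i - a - s = i - s' := by omega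
              simp [ext, hi0, hi1, hi2, hi3, hi5, hi4]
            · have hi3 : ¬ i - a < s := by omega
              have hi4 : ¬ i - a - s < 2 * n₁ := by omega
              have hi5 : i - a - s - 2 * n₁ = i - (s' + 2 * n₁) := by omega
              simp [ext, hi0, hi1, hi2, hi3, hi4, hi5]
      · rw [dif_neg hi]
        have hi0 : ¬ i < a := by omega
        have hi3 : ¬ i - a < s := by omega
        have hi4 : ¬ i - a - s < 2 * n₁ := by omega
        have hi5 : i - a - s - 2 * n₁ = i - (s' + 2 * n₁) := by omega
        simp [hi0, hi3, hi4, hi5, hHbit i (not_lt.mp hi)]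
    calc Nat.ofBits (fun j : Fin (2 * n) => ext zz j) + 1
        = 2 ^ a * (2 ^ s * (2 ^ (2 * n₁) * H + Nat.ofBits (fun k : Fin (2 * n₁) => zz k)) + Q) +
            (2 ^ a - 1) + 1 := by rw [h1]
      _ = 2 ^ a * (2 ^ s * (2 ^ (2 * n₁) * H + Nat.ofBits (fun k : Fin (2 * n₁) => zz k)) + Q) +
            2 ^ a := by rw [Nat.add_assoc, Nat.sub_add_cancel Nat.one_le_two_pow]
      _ = 2 ^ a * (2 ^ s * (Nat.ofBits (fun k : Fin (2 * n₁) => zz k) + 2 ^ (2 * n₁) * H) + Q + 1) := by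
          ring
  -- (3) the local number of the merged stream is `N_{π₁}(r₁, c₁)`
  have hloc : ∀ r₁ c₁, (fun k : Fin (2 * n₁) => z r₁ c₁ k) =
      fun k : Fin (2 * n₁) => Sum.elim r₁ c₁ (π₁.symm k) := by
    intro r₁ c₁
    funext k
    simp [z, k.isLt]
  -- (4) entries of the submatrix
  have hentry : ∀ r₁ c₁, M (ρ r₁) (γ c₁) = (-1 : ℂ) ^ a * M₁ r₁ c₁ := by
    intro r₁ c₁
    have hfun : (fun j : Fin (2 * n) => Sum.elim (ρ r₁) (γ c₁) (π.symm j)) =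
        fun j : Fin (2 * n) => ext (z r₁ c₁) j := funext (hglob r₁ c₁)
    have hN : Nat.ofBits (fun j : Fin (2 * n) => Sum.elim (ρ r₁) (γ c₁) (π.symm j)) + 1 =
        2 ^ a * (2 ^ s * (Nat.ofBits (fun k : Fin (2 * n₁) => Sum.elim r₁ c₁ (π₁.symm k)) +
          2 ^ (2 * n₁) * H) + Q + 1) := by
      rw [hfun, hext (z r₁ c₁), hloc r₁ c₁]
    simp only [hM, hM₁, Matrix.of_apply]
    rw [hN, liouville_two_pow_mul]
    push_cast
    ring
  -- (5) the submatrix is `(-1)^a • M₁`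
  have hsub : M.submatrix ρ γ = ((-1 : ℂ) ^ a) • M₁ := by
    ext r₁ c₁
    simp only [Matrix.submatrix_apply, Matrix.smul_apply, smul_eq_mul]
    exact hentry r₁ c₁
  have hM₁eq : M₁ = ((-1 : ℂ) ^ a) • M.submatrix ρ γ := by
    rw [hsub, smul_smul, ← mul_pow, neg_one_mul, neg_neg, one_pow, one_smul]
  calc M₁.rank = (((-1 : ℂ) ^ a) • M.submatrix ρ γ).rank := by rw [← hM₁eq]
    _ = (Matrix.diagonal (fun _ : Fin n₁ → Bool => (-1 : ℂ) ^ a) * M.submatrix ρ γ).rank := by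
        rw [Matrix.smul_eq_diagonal_mul]
    _ ≤ (M.submatrix ρ γ).rank := Matrix.rank_mul_le_right _ _
    _ ≤ M.rank := Matrix.rank_submatrix_le M ρ γ

end Summit.ValiantsHypothesis.ValiantsHypothesis.Theorems.LiouvilleSarnakLiouvilleCutRank.KernelBlock
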